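import Literature.MathematicalPhysics.QuantumFieldTheory.Balaban1983to89.B6Ineq2110TwoScaleV1
import Literature.MathematicalPhysics.QuantumFieldTheory.Balaban1983to89.B6Ineq2147TwoScaleV1Upper

/-!
# `Balaban1983to89.B6Cov2110TwoScaleV1` — T. Bałaban, *Propagators and renormalization transformations for lattice gauge
# theories. II*, Commun. Math. Phys. **96** (1984) 223–250 [Balaban1984PropagatorsII], p. 242 (text after (2.110)): **the covariance
# `C^{(j)}_Λ` of the last Gaussian integrals in (2.106) IS A BOUNDED OPERATOR — FOR THE CONCRETE TWO-SCALE DATA `tsV1`**, with the two-sided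
# bounds `γ₁⁻¹ ≤ C^{(j)}_Λ ≤ γ₀⁻¹` on the admissible `ω` from (2.110)

statement-level skeleton of published theorems with citation tags; proofs where landed; nothing here is a claim about the Yang–Mills mass gap

PDF held: `paper:balaban1984-cmp96-propagators-rt-ii` (journal page = PDF page + 222; p. 242 [PDF 20] read AS IMAGE on the ×2 render
`run/shared/lean/pub/pub-balaban/b2b-balaban-ref1/pages/1984-cmp96-propagators-rt-II/…-p020-x2.png`, 2026-08-21).

PRINT (verbatim, p. 242).  *"Hence γ₀‖ω‖² ≤ ⟨ω, Δ′_jω⟩ ≤ γ₁‖ω‖² for ω : Q′₁ω = 0, (2.110) with positive constants γ₀, γ₁ dependent on d and L only.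
From the theorem on unit lattice operators in [3] it follows that a covariance C^{(j)}_Λ of the last Gaussian integrals in (2.106) is a bounded
operator with an exponential decay independent of j and Λ."*

CITATION HEADER (lean-in-tree rule) — WHAT IS REPRODUCED.  Phase-2 file of the `lit-balaban` typed skeleton (HOME
`run/shared/lean/pub/lit-balaban/`), seat **p22 gen 11** (B6 fold owner r03, referee ref-4; lane = the Sect. C chain (2.95)–(2.147) on the
concrete two-scale data `tsV1`).  SKELETON row **B6.Eq2.110** (*"(2.110) + C^{(j)}_Λ"*; decl of record r03's `…B6DeltaPrime2110Torus.ineq2110`,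
untouched).  IMPORTS BY NAME: the same seat's `…B6Ineq2110TwoScaleV1.ineq2110_V1_lower/_upper` ((2.110) for the concrete `Δ′_j` of `tsV1`),
gen 10's generic covariance bounds `…B6Ineq2147TwoScaleV1Upper.inner_covOp_le_of_ge` (`S ≥ γ` on `K` ⇒ `C ≤ γ⁻¹`) and
`…B6Ineq2147TwoScaleV1.inner_covOp_ge_of_le` (`S ≤ U` on `K` ⇒ `C ≥ U⁻¹` on `K`), gen 8's `…B6SectCPositivity.Dp_pos/Dp_symm` and
`…B6SectCTwoScaleV1Lattice.isLattice/positive`; gen 7's `…B6SectCOperators.TwoScaleData.C = covOp S₁ Δ′_j` is the typed `C^{(j)}_Λ`.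
THIS FILE, for `tsV1 hc Λ′ w` (`c ≠ 0`, `j + 1 ≤ m + K`, weights `w > 0`), `θ = (c/L^j)⁴L^{jd}`, `γ₀ = θ·c₀(d)(8/L²)²`, `γ₁ = θ·γ₁(d)`:
* **`inner_C_le_V1`**: `⟨v, C^{(j)}_Λv⟩ ≤ γ₀⁻¹‖P_{S₁}v‖²` for every `v` (`S₁` = the admissible `ω`), hence **`inner_C_le_V1'`**: `⟨v, C^{(j)}_Λv⟩ ≤
  γ₀⁻¹‖v‖²` — *"C^{(j)}_Λ … is a bounded operator"*, the bound uniform in `Λ′` and in the volume;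
* **`inner_C_ge_V1`**: `γ₁⁻¹‖ω‖² ≤ ⟨ω, C^{(j)}_Λω⟩` on the admissible `ω`; **`cov2110_V1`**: both, for admissible `ω`.
THEOREMS ONLY (no definition, no `def … : Prop` fact); standard axioms.  HONEST SCOPE: *"bounded operator"* is rendered as the form bound
`⟨v, Cv⟩ ≤ γ₀⁻¹‖v‖²` for the (symmetric, positive) typed `C^{(j)}_Λ`; constants = r03's d,L-only ones times the V1 normalisation `θ` (so
uniform in `Λ′` and the volume; `j` and `c` enter through `θ` only — print works at unit normalisation); the printed route *"from the theorem on
unit lattice operators in [3]"* and the *"exponential decay independent of j and Λ"* clause are NOT reproduced (the bound here is read off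
(2.110) directly); finite tori of the V1 calculus, centred blocks (`L` odd); NOT summit progress.
-/

noncomputable section

open scoped InnerProductSpace

namespace Literature.MathematicalPhysics.QuantumFieldTheory.Balaban1983to89.B6Cov2110TwoScaleV1

open LatticeFieldCalculus B6SectCTwoScaleV1 B6SectCTwoScaleV1Lattice B6CovarianceOperator
open B6SectCOperators (TwoScaleData)
open B6SectCPositivity (Dp_pos Dp_symm)
open B6Hprime2101 (c0_2109 gamma1_2109 c1_2109_pos)
open B6Ineq2110TwoScaleV1 (ineq2110_V1_lower ineq2110_V1_upper gamma0_V1_pos)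
open B6Ineq2147TwoScaleV1Upper (inner_covOp_le_of_ge)
open B6Ineq2147TwoScaleV1 (inner_covOp_ge_of_le)

variable {P : Params} {c : ℝ} (hc : c ≠ 0) {j : ℕ} (hj : j + 1 ≤ P.m + P.K) (Λ' : Finset (Site P (j + 1)))
  {w : CIdx j Λ' → ℝ} (hw : ∀ i, 0 < w i)

include hc hj hw

omit hj hw in
/-- the upper constant `γ₁ = θ·γ₁(d)` of (2.110) for the V1 data is positive (`c ≠ 0`, `d ≥ 1`). [cite: Balaban1984PropagatorsII, (2.110) p.242] -/
theorem gamma1_V1_pos : 0 < (c / (P.L : ℝ) ^ j) ^ 4 * ((P.L : ℝ) ^ j) ^ P.d * gamma1_2109 P.d := by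
  have hL := P.cast_L_pos
  have hd : (0 : ℝ) < P.d := Nat.cast_pos.mpr (by have := P.hd; omega)
  have h4 : 0 < (c / (P.L : ℝ) ^ j) ^ 4 := Even.pow_pos ⟨2, rfl⟩ (div_ne_zero hc (pow_ne_zero _ hL.ne'))
  have hγ : 0 < gamma1_2109 P.d := by
    unfold gamma1_2109
    exact mul_pos (c1_2109_pos _) (by positivity)
  exact mul_pos (mul_pos h4 (pow_pos (pow_pos hL _) _)) hγ

/-- **`C^{(j)}_Λ ≤ γ₀⁻¹`** for the two-scale data: `⟨v, C^{(j)}_Λv⟩ ≤ γ₀⁻¹‖P_{S₁}v‖²` for every `v`, `γ₀ = θ·c₀(d)(8/L²)²` the lower constant of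
(2.110) for the concrete `Δ′_j` (`S₁` = the admissible `ω`; the covariance is an inverse of `Δ′_j` on `S₁`).
[cite: Balaban1984PropagatorsII, p.242 (text after (2.110))] -/
theorem inner_C_le_V1 (v : USite P j) :
    ⟪v, (tsV1 hc Λ' w).C v⟫_ℝ ≤
      ((c / (P.L : ℝ) ^ j) ^ 4 * ((P.L : ℝ) ^ j) ^ P.d * (c0_2109 P.d * (8 / (P.L : ℝ) ^ 2) ^ 2))⁻¹ *
        ‖(admissible P j Λ').starProjection v‖ ^ 2 :=
  inner_covOp_le_of_ge (admissible P j Λ') (tsV1 hc Λ' w).Dp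
    (fun k hk => Dp_pos (isLattice Λ' hc hj hw) (positive Λ' hc hj w) k hk) (gamma0_V1_pos (j := j) hc)
    (fun k => ineq2110_V1_lower hc Λ' w hj k k.2) v

/-- **p. 242 *"C^{(j)}_Λ … is a bounded operator"* for the two-scale data**: `⟨v, C^{(j)}_Λv⟩ ≤ γ₀⁻¹‖v‖²` for every `v`, the bound uniform
in `Λ′` and in the volume. [cite: Balaban1984PropagatorsII, p.242 (text after (2.110))] -/
theorem inner_C_le_V1' (v : USite P j) :
    ⟪v, (tsV1 hc Λ' w).C v⟫_ℝ ≤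
      ((c / (P.L : ℝ) ^ j) ^ 4 * ((P.L : ℝ) ^ j) ^ P.d * (c0_2109 P.d * (8 / (P.L : ℝ) ^ 2) ^ 2))⁻¹ * ‖v‖ ^ 2 := by
  have h1 := inner_C_le_V1 hc hj Λ' hw v
  have h2 : ‖(admissible P j Λ').starProjection v‖ ^ 2 ≤ ‖v‖ ^ 2 :=
    pow_le_pow_left₀ (norm_nonneg _) (Submodule.norm_starProjection_apply_le (K := admissible P j Λ') v) 2
  exact h1.trans (mul_le_mul_of_nonneg_left h2 (inv_nonneg.2 (gamma0_V1_pos (j := j) hc).le))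

/-- **`C^{(j)}_Λ ≥ γ₁⁻¹` on the admissible `ω`** for the two-scale data: `γ₁⁻¹‖ω‖² ≤ ⟨ω, C^{(j)}_Λω⟩`, `γ₁ = θ·γ₁(d)` the upper constant of
(2.110) (*"an inverse to the operator of the quadratic form, hence … bounded from below by an inverse of an upper bound of this form"*, p. 248,
applied to `Δ′_j` on `S₁`). [cite: Balaban1984PropagatorsII, p.242 (text after (2.110)) + p.248 (text after (2.146))] -/
theorem inner_C_ge_V1 (ω : USite P j) (hω : ω ∈ admissible P j Λ') :
    ((c / (P.L : ℝ) ^ j) ^ 4 * ((P.L : ℝ) ^ j) ^ P.d * gamma1_2109 P.d)⁻¹ * ‖ω‖ ^ 2 ≤ ⟪ω, (tsV1 hc Λ' w).C ω⟫_ℝ :=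
  inner_covOp_ge_of_le (admissible P j Λ') (tsV1 hc Λ' w).Dp (Dp_symm (isLattice Λ' hc hj hw))
    (fun k hk => Dp_pos (isLattice Λ' hc hj hw) (positive Λ' hc hj w) k hk) (gamma1_V1_pos (j := j) hc)
    (fun k => ineq2110_V1_upper hc Λ' w (by omega) k) ⟨ω, hω⟩

/-- **`γ₁⁻¹ ≤ C^{(j)}_Λ ≤ γ₀⁻¹` on the admissible `ω`, for the two-scale data `tsV1`** — the covariance of the Gaussian `∫dω↾_Λ δ(Q′₁ω)
exp[−½⟨ω, Δ′_jω⟩]` of (2.106) is bounded (and bounded from below on its carrier) with constants uniform in `Λ′` and the volume.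
[cite: Balaban1984PropagatorsII, p.242 (text after (2.110))] -/
theorem cov2110_V1 (ω : USite P j) (hω : ω ∈ admissible P j Λ') :
    ((c / (P.L : ℝ) ^ j) ^ 4 * ((P.L : ℝ) ^ j) ^ P.d * gamma1_2109 P.d)⁻¹ * ‖ω‖ ^ 2 ≤ ⟪ω, (tsV1 hc Λ' w).C ω⟫_ℝ ∧
      ⟪ω, (tsV1 hc Λ' w).C ω⟫_ℝ ≤
        ((c / (P.L : ℝ) ^ j) ^ 4 * ((P.L : ℝ) ^ j) ^ P.d * (c0_2109 P.d * (8 / (P.L : ℝ) ^ 2) ^ 2))⁻¹ * ‖ω‖ ^ 2 :=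
  ⟨inner_C_ge_V1 hc hj Λ' hw ω hω, inner_C_le_V1' hc hj Λ' hw ω⟩

end Literature.MathematicalPhysics.QuantumFieldTheory.Balaban1983to89.B6Cov2110TwoScaleV1

end
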